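import Literature.MathematicalPhysics.QuantumFieldTheory.Balaban1983to89.B9Ineq377L2

/-!
# `Balaban1983to89.B9Ineq368L2RZero` — B9 p. 403 (3.68) IN BLOCK-`ℓ²`, THE WORD LEVEL: the four entries of
# `F(A) = R₀(U′U) − R₀(U) = G̃MʹG̃ − GMG` from the entries of `G = G′(U)`, `G̃ = G′(U′U)`, their SMALL difference `G̃ − G`, the sandwiched
# `C⁻¹`-letters `M = Q′*C⁻¹(U)Q′`, `M′ = Q′*(U′U)C⁻¹(U′U)Q′(U′U)` and their SMALL difference `M′ − M`

T. Bałaban, *Propagators for lattice gauge theories in a background field*, Commun. Math. Phys. **99** (1985) 389–434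
[`Balaban1985BackgroundPropagators`, "B9"]; [4] = T. Bałaban, *Propagators and renormalization transformations for lattice gauge theories. II*,
Commun. Math. Phys. **96** (1984) 223–250 [`Balaban1984PropagatorsII`].

statement-level skeleton of published theorems with citation tags; proofs where landed; nothing here is a claim about the Yang–Mills mass gap

THE PRINTED LOCUS (verbatim).  (3.68) p. 403: *"P(U′U) = P(U) + P′(A), … |P′(A)| ≦ O(1)α₁e^{−δd}"* (with P = I − R, R(V) = G′(V)Q′*(V)C⁻¹(V)Q′(V)G′(V),
(3.25) p. 394); obtained in print from (3.64)–(3.65) (G′(U′U) − G′(U)), (3.57) (Q′(U′U) = Q′ + F′) and (3.66)–(3.67) (C⁻¹(U′U) − C⁻¹(U)).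

WHY THIS FILE (pub-ymgap N06 row 13, G-side `ℓ²` route, GSIDE-L2-SPEC v4 §F2a).  After `B9SectBL2GStepAtLettersV2` (g6) the twelve `L²` member-steps of
Sect. B are theorems on the letters, modulo ONE displayed printed inequality inside `L2GFrame₂`: (3.77) in block-ℓ² for the concrete `P₁(A)`, whose proof
(`B9Ineq377L2Hom.ineq377_l2_concreteE`) wants the (3.49) entries of `R₀(U)` (from readings: `B9Ineq349L2HomReadings`) and the four (3.68) entries of
`F(A) = R₀(U′U) − R₀(U)` in block-ℓ².  THIS FILE is the WORD LEVEL of the latter, on one carrier with abstract letters (r06's sup twin: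
`B9Ineq368Vprime`, which expands `P′(A)` into words each containing one small letter): the algebra
`G̃M′G̃ − GMG = (G̃ − G)M′G̃ + G(M′ − M)G̃ + GM(G̃ − G)` and three applications of g5's `B9Ineq377L2.hasL2Majorant_word349` (the (3.49)-word in block-ℓ² at
`Q = Q* = 1`), for arbitrary outer letters `X` (weight `w_X`: `X = 1`, `(Lʲη)²`-type entries; `X = ∇_μ`) and `Y` (`Y = 1`, `Y = ∇♯_ν`).  The SMALL inputs —
`X(G̃ − G)`, `(G̃ − G)Y` (from (3.65) and the block-ℓ² (3.63): `B9Ineq363L2*`) and `M′ − M` (from (3.57), (3.66)–(3.67) through the lattice of blocks: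
successor §F2b) — are HYPOTHESES here with their small constants `θ_X, θ_Y, θ_M`.

HONEST SCOPE.  Finite-dimensional bookkeeping on abstract letters; nothing of [B9] asserted for Bałaban's operators; count-neutral; NOT a node discharge;
nothing continuum ∕ OS ∕ mass-gap ∕ Clay.  Cell `pub-ymgap` (HUMAN RULING D-0062), Track A node N06 [B9], N06-ASSIGNMENT row 13, seat `pub-ymgap-dag-n06-c`
(g6), 2026-08-27.
-/

noncomputable section

open scoped BigOperators

namespace Literature.MathematicalPhysics.QuantumFieldTheory.Balaban1983to89.B9Ineq368L2RZero

open Literature.MathematicalPhysics.QuantumFieldTheory.Balaban1983to89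
open Literature.MathematicalPhysics.QuantumFieldTheory.Balaban1983to89.B6RandomWalk (Triangle254 Ineq261)
open Literature.MathematicalPhysics.QuantumFieldTheory.Balaban1983to89.B6RandomWalkL2 (HasL2Majorant hasL2Majorant_mono hasL2Majorant_add
  hasL2Majorant_one)
open Literature.MathematicalPhysics.QuantumFieldTheory.Balaban1983to89.B9Thm34Ext (toB6)
open Literature.MathematicalPhysics.QuantumFieldTheory.Balaban1983to89.B9Ineq347 (ScaleTransfer)
open Literature.MathematicalPhysics.QuantumFieldTheory.Balaban1983to89.B9Ineq377L2 (hasL2Majorant_word349)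

variable {g : B9.Geometry} [Fintype g.Site] [DecidableEq g.Site] {R : ℝ} {H : Prop} {W : Type} [Fintype W]

/-- **(3.68) at the operator level, the algebra**: `G̃M′G̃ − GMG = (G̃ − G)M′G̃ + G(M′ − M)G̃ + GM(G̃ − G)` — every word contains exactly one of the
small differences `G̃ − G` ((3.64)–(3.65)), `M′ − M` ((3.57), (3.66)–(3.67)). [folklore] [cite: Balaban1985BackgroundPropagators, (3.68) p.403] -/
theorem rzero_sub_expand {A : Type*} [Ring A] (G Gt M M' : A) :
    Gt * M' * Gt - G * M * G = (Gt - G) * M' * Gt + G * (M' - M) * Gt + G * M * (Gt - G) := by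
  noncomm_ring

/-- ★★ **(3.68) IN BLOCK-`ℓ²`, THE WORD LEVEL — the entry `X·(G̃M′G̃ − GMG)·Y` for arbitrary outer letters.**  INPUTS at a common rate `δ`: the
entries `XG ≺₂ B_X w_X e^{−δd}` and the SMALL one `X(G̃ − G) ≺₂ θ_X w_X e^{−δd}`; `G̃Y ≺₂ B_Y w_Y e^{−δd}` and `(G̃ − G)Y ≺₂ θ_Y w_Y e^{−δd}`; the
sandwiched letters `M ≺₂ B_M(Lʲη)⁻⁴e^{−δd}`, `M′ ≺₂ B_{M′}(Lʲη)⁻⁴e^{−δd}` and the SMALL `M′ − M ≺₂ θ_M(Lʲη)⁻⁴e^{−δd}`; the p. 398 transfers of `w_Y` and of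
`(Lʲη)⁻⁴` at `(δ₀, α)` (`Λ ≧ 1`), (2.61) at `β`, `ρ + (2α+β)δ₀ ≦ δ`.  CONCLUSION:
`X·(G̃M′G̃ − GMG)·Y ≺₂ Λ⁴c₁(β)²·(θ_X B_{M′} B_Y + B_X θ_M B_Y + B_X B_M θ_Y)·w_X(y)(Lʲη)⁻⁴w_Y(y)·e^{−ρd}` — `rzero_sub_expand` and
`B9Ineq377L2.hasL2Majorant_word349` (at `Q = Q* = 1`) on each of the three words.  Print: `X, Y ∈ {1, ∇}`, all three `θ = O(α₁)`.
[cite: Balaban1985BackgroundPropagators, (3.68) p.403 + (3.25) p.394 + (3.49) p.399 + (3.57) p.402 + (3.64)–(3.67) pp.402–403; Balaban1984PropagatorsII, Lemma 2.1 p.234 + (2.52)–(2.55) p.232 + Prop. 2.6 (2.140)–(2.141) p.247] -/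
theorem ineq368_l2_word (blk : W → g.Site) (d : ℕ) (δ₀ δ α β ρ Λ BX BY BM BM' θX θY θM : ℝ) (wX wY : g.Site → ℝ)
    (hwX : ∀ a, 0 ≤ wX a) (hwY : ∀ a, 0 ≤ wY a) (hBX : 0 ≤ BX) (hBY : 0 ≤ BY) (hBM : 0 ≤ BM) (hBM' : 0 ≤ BM') (hθX : 0 ≤ θX)
    (hθY : 0 ≤ θY) (hθM : 0 ≤ θM) (hΛ : 1 ≤ Λ) (hρ : 0 ≤ ρ) (hα : 0 ≤ α) (hβ : 0 ≤ β) (hδ₀ : 0 ≤ δ₀) (hr : ρ + (2 * α + β) * δ₀ ≤ δ)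
    (hdnn : ∀ a b : g.Site, 0 ≤ g.dist a b) (htri : Triangle254 (toB6 g R H)) (h261 : Ineq261 d (toB6 g R H) δ₀ β)
    (hTY : ScaleTransfer g δ₀ α Λ wY) (hT4 : ScaleTransfer g δ₀ α Λ (fun a => (g.len a ^ 4)⁻¹))
    {X Y G Gt M M' : Module.End ℝ (W → ℝ)}
    (hXG : HasL2Majorant (g := toB6 g R H) blk (X * G) (fun a b => BX * wX a * Real.exp (-(δ * g.dist a b))))
    (hXd : HasL2Majorant (g := toB6 g R H) blk (X * (Gt - G)) (fun a b => θX * wX a * Real.exp (-(δ * g.dist a b))))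
    (hGtY : HasL2Majorant (g := toB6 g R H) blk (Gt * Y) (fun a b => BY * wY a * Real.exp (-(δ * g.dist a b))))
    (hdY : HasL2Majorant (g := toB6 g R H) blk ((Gt - G) * Y) (fun a b => θY * wY a * Real.exp (-(δ * g.dist a b))))
    (hM : HasL2Majorant (g := toB6 g R H) blk M (fun a b => BM * (g.len a ^ 4)⁻¹ * Real.exp (-(δ * g.dist a b))))
    (hM' : HasL2Majorant (g := toB6 g R H) blk M' (fun a b => BM' * (g.len a ^ 4)⁻¹ * Real.exp (-(δ * g.dist a b))))
    (hdM : HasL2Majorant (g := toB6 g R H) blk (M' - M) (fun a b => θM * (g.len a ^ 4)⁻¹ * Real.exp (-(δ * g.dist a b)))) :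
    HasL2Majorant (g := toB6 g R H) blk (X * (Gt * M' * Gt - G * M * G) * Y)
      (fun a b => (Λ ^ 4 * B6.c1 d δ₀ β ^ 2 * (θX * BM' * BY + BX * θM * BY + BX * BM * θY)) *
        (wX a * ((g.len a ^ 4)⁻¹ * wY a)) * Real.exp (-(ρ * g.dist a b))) := by
  -- the identity letter in the two `Q`-slots of the (3.49)-word
  have h1 : HasL2Majorant (g := toB6 g R H) blk (1 : Module.End ℝ (W → ℝ)) (fun a b : g.Site => if a = b then (1 : ℝ) else 0) :=
    hasL2Majorant_one (g := toB6 g R H) blk (fun y => by simp) (fun a b => by split_ifs <;> norm_num)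
  -- the three words, each with its one small letter
  have w1 := hasL2Majorant_word349 (R := R) (H := H) blk d δ₀ δ α β ρ Λ 1 θX BM' BY wX wY hwX hwY zero_le_one hθX hBM' hBY hΛ hρ hα hβ
    hδ₀ hr hdnn htri h261 hTY hT4 hXd hGtY h1 h1 hM'
  have w2 := hasL2Majorant_word349 (R := R) (H := H) blk d δ₀ δ α β ρ Λ 1 BX θM BY wX wY hwX hwY zero_le_one hBX hθM hBY hΛ hρ hα hβ
    hδ₀ hr hdnn htri h261 hTY hT4 hXG hGtY h1 h1 hdM
  have w3 := hasL2Majorant_word349 (R := R) (H := H) blk d δ₀ δ α β ρ Λ 1 BX BM θY wX wY hwX hwY zero_le_one hBX hBM hθY hΛ hρ hα hβ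
    hδ₀ hr hdnn htri h261 hTY hT4 hXG hdY h1 h1 hM
  -- the operator identity
  have e : X * (Gt * M' * Gt - G * M * G) * Y
      = X * (Gt - G) * 1 * M' * 1 * (Gt * Y) + X * G * 1 * (M' - M) * 1 * (Gt * Y) + X * G * 1 * M * 1 * ((Gt - G) * Y) := by
    rw [rzero_sub_expand]; noncomm_ring
  rw [e]
  refine hasL2Majorant_mono (g := toB6 g R H) blk
    (hasL2Majorant_add (g := toB6 g R H) blk (hasL2Majorant_add (g := toB6 g R H) blk w1 w2) w3) fun a b => le_of_eq ?_
  ring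

end Literature.MathematicalPhysics.QuantumFieldTheory.Balaban1983to89.B9Ineq368L2RZero
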